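import Summits.BirchSwinnertonDyer.BirchSwinnertonDyer.Theorems.ClassRecordThreeEulerHalvesAtThreeCartanCoverSplitTransport
import Literature.NumberTheory.Automorphic.QuaternionOrderHeckeOperatorCuspForms
import Literature.NumberTheory.Automorphic.ShimuraCurveCartanLevelHeckeDegree
import Literature.NumberTheory.Automorphic.BrandtModuleSplitLocal
import Literature.NumberTheory.EllipticCurves.ComplexMultiplicationLFunctionIsogenyHoldsProofs
import HarnessLib

/-!
# Crux NUM `CartanOnePlaceDegreeLawAtThree` (stmt-BirchSwinnertonDyer-24801), node `cmrank` — (HT) SPLIT HECKE TRANSPORT: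
# the Hecke operators of the split sub-order `O_s` on the transported class-minimal form `Q'.form ∣ g⁻¹`

Seat `bsd-stepL-tam3-p1` g33 (LEAD of crux 24801; `--supports stmt-BirchSwinnertonDyer-24801`). The cmrank node's ATTACKABLE stub `stub_splitHeckeTransport`
(`Cruxes/CartanOnePlaceDegreeLawAtThree/Lines/cmrank.lean`, cruxidea g10) AS A THEOREM (`splitHeckeTransport`, the def body of the node's `SplitHeckeTransport`
VERBATIM as the statement). With the landed (DESC) (`…CMRankDescent`, p765207) this makes the node's derivation of (KTYPE) `SplitDockingMultiplicityOne`'s use —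
(T+P) `SplitSideTransportAtThree` — rest on the print leaf (ISO) alone (`splitSideTransport_of_iso`).
* §1 `unitsHeckeFun_slash_conj` — CONJUGATION TRANSPORT of the Hecke operators of quaternion orders (pure bookkeeping, Shimura §3.3): for two orders with real
  splittings `(ι, O)`, `(ι', O')` and `g ∈ GL₂(ℝ)` with `ι(O) = g ι'(O') g⁻¹`, `T_n^{O}(h ∣ g⁻¹) = (T_n^{O'} h) ∣ g⁻¹` for every `ι'(O'¹)`-invariant `h` (conjugation
  by `g` is a bijection of the Hecke sets `ι'(O'(n)) → ι(O(n))` and of the norm-one groups, hence of the coset spaces; representatives differ by norm-one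
  units, absorbed by `h`).
* §2 `splitHeckeTransport` — (HT): the split sub-order `O_s = {y ∈ O₀' : R.red y diagonal}` is an order (`1 ∈ O_s`, closed under `·`, full lattice as
  `q O₀' ⊆ O_s ⊆ O₀'` — `isFullLattice_of_between`), `ι(O_s) = g ι'(X'.O) g⁻¹` by the X3 clause `HO`, the coset space `X'.Γ∖X'.O(ℓ)` is finite by (HD)
  `cartanLevel_card_heckeCosets_eq_holds`, so `T_ℓ^{O_s}(Q'.form ∣ g⁻¹) = (T_ℓ^{X'} Q'.form) ∣ g⁻¹ = a_ℓ(W₂)·(Q'.form ∣ g⁻¹)` (`Q'.hecke_eq`) and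
  `a_ℓ(W₂) = a_ℓ(V)` (`LFunction_eq_of_isIsogenous_holds`).
HONEST: bookkeeping; nothing about NUM for any curve, 23422, 19109 or BSD is proved; BSD is proved for no curve.
[cite: ShimuraIATAF1971, §3.3 (3.3.12)–(3.3.14) pp. 74–75 and Prop. 3.37 p. 76] [cite: KohenPacetti2016, §1.3 and §2]
-/

set_option linter.dupNamespace false
set_option autoImplicit false

noncomputable section

open scoped Classical MatrixGroups ModularForm UpperHalfPlane

namespace Summit.BirchSwinnertonDyer.BirchSwinnertonDyer.Theorems.CartanCover.CMRank

open Literature.NumberTheory.Automorphic WeierstrassCurve Literature.NumberTheory.EllipticCurves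
  Literature.NumberTheory.EllipticCurves.Rank1Residual Summit.BirchSwinnertonDyer.Rank1Residual
open Matrix

/-! ## §1 Conjugation transport of the Hecke operators of quaternion orders -/

section Transport

variable {B B' : Type*} [Ring B] [Algebra ℚ B] [Ring B'] [Algebra ℚ B']
  (ιB : B →ₐ[ℚ] Matrix (Fin 2) (Fin 2) ℝ) {O : Submodule ℤ B} (hO : Brandt.IsOrder B O)
  (ιB' : B' →ₐ[ℚ] Matrix (Fin 2) (Fin 2) ℝ) {O' : Submodule ℤ B'} (hO' : Brandt.IsOrder B' O')
  (g : GL (Fin 2) ℝ)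
  (HO : ∀ m : Matrix (Fin 2) (Fin 2) ℝ, (∃ x ∈ O', ιB' x = m) ↔
    ∃ y ∈ O, ιB y = (g : Matrix (Fin 2) (Fin 2) ℝ) * m * ((g⁻¹ : GL (Fin 2) ℝ) : Matrix (Fin 2) (Fin 2) ℝ))

/-- `det(g a g⁻¹) = det a`. [folklore] -/
theorem det_conj (a : GL (Fin 2) ℝ) : Matrix.GeneralLinearGroup.det (g * a * g⁻¹) = Matrix.GeneralLinearGroup.det a := by
  rw [map_mul, map_mul, map_inv, mul_inv_cancel_comm]

include HO

/-- Conjugation by `g` carries the Hecke set `ι'(O'(n))` onto `ι(O(n))`. [cite: ShimuraIATAF1971, §3.3] -/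
theorem conj_mem_unitsHeckeSet_iff (n : ℕ) (a : GL (Fin 2) ℝ) :
    g * a * g⁻¹ ∈ unitsHeckeSet ιB (O := O) n ↔ a ∈ unitsHeckeSet ιB' (O := O') n := by
  rw [mem_unitsHeckeSet_iff, mem_unitsHeckeSet_iff, HO, ← Matrix.GeneralLinearGroup.val_det_apply,
    ← Matrix.GeneralLinearGroup.val_det_apply, det_conj, Units.val_mul, Units.val_mul]

/-- Conjugation by `g` carries the norm-one group `ι'(O'¹)` onto `ι(O¹)`. [cite: ShimuraIATAF1971, §3.3] -/
theorem conj_mem_normOneUnits_iff (δ : GL (Fin 2) ℝ) :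
    g * δ * g⁻¹ ∈ normOneUnits ιB hO ↔ δ ∈ normOneUnits ιB' hO' := by
  rw [mem_normOneUnits_iff, mem_normOneUnits_iff, HO, HO, show (g * δ * g⁻¹)⁻¹ = g * δ⁻¹ * g⁻¹ by group,
    Units.val_mul, Units.val_mul, Units.val_mul, Units.val_mul, det_conj]

/-- **CONJUGATION TRANSPORT OF HECKE OPERATORS**: if `ι(O) = g ι'(O') g⁻¹` then `T_n^{O}(h ∣ g⁻¹) = (T_n^{O'} h) ∣ g⁻¹` for every `ι'(O'¹)`-invariant
`h` (finite coset space). [cite: ShimuraIATAF1971, §3.3 (3.3.12)–(3.3.14) and Prop. 3.37 p. 76] -/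
theorem unitsHeckeFun_slash_conj (n : ℕ) [Fintype (Quotient (unitsHeckeSetoid ιB' hO' n))] (h : ℍ → ℂ)
    (hh : ∀ δ ∈ normOneUnits ιB' hO', h ∣[(2 : ℤ)] δ = h) :
    unitsHeckeFun ιB hO n (h ∣[(2 : ℤ)] g⁻¹) = (unitsHeckeFun ιB' hO' n h) ∣[(2 : ℤ)] g⁻¹ := by
  classical
  -- conjugation maps between the Hecke sets
  let φ : unitsHeckeSet ιB' (O := O') n → unitsHeckeSet ιB (O := O) n :=
    fun a => ⟨g * a * g⁻¹, (conj_mem_unitsHeckeSet_iff ιB ιB' g HO n a).mpr a.2⟩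
  let ψ : unitsHeckeSet ιB (O := O) n → unitsHeckeSet ιB' (O := O') n :=
    fun a => ⟨g⁻¹ * a * g, (conj_mem_unitsHeckeSet_iff ιB ιB' g HO n _).mp
      (by rw [show g * (g⁻¹ * (a : GL (Fin 2) ℝ) * g) * g⁻¹ = a by group]; exact a.2)⟩
  have hφ : ∀ a b : unitsHeckeSet ιB' (O := O') n,
      (unitsHeckeSetoid ιB' hO' n) a b → (unitsHeckeSetoid ιB hO n) (φ a) (φ b) := by
    rintro a b ⟨δ, hδ, hab⟩
    refine ⟨g * δ * g⁻¹, (conj_mem_normOneUnits_iff ιB hO ιB' hO' g HO δ).mpr hδ, ?_⟩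
    show g * δ * g⁻¹ * (g * (a : GL (Fin 2) ℝ) * g⁻¹) = g * (b : GL (Fin 2) ℝ) * g⁻¹
    rw [← hab]; group
  have hψ : ∀ a b : unitsHeckeSet ιB (O := O) n,
      (unitsHeckeSetoid ιB hO n) a b → (unitsHeckeSetoid ιB' hO' n) (ψ a) (ψ b) := by
    rintro a b ⟨γ, hγ, hab⟩
    refine ⟨g⁻¹ * γ * g, (conj_mem_normOneUnits_iff ιB hO ιB' hO' g HO (g⁻¹ * γ * g)).mp
      (by rw [show g * (g⁻¹ * γ * g) * g⁻¹ = γ by group]; exact hγ), ?_⟩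
    show g⁻¹ * γ * g * (g⁻¹ * (a : GL (Fin 2) ℝ) * g) = g⁻¹ * (b : GL (Fin 2) ℝ) * g
    rw [← hab]; group
  let e : Quotient (unitsHeckeSetoid ιB' hO' n) ≃ Quotient (unitsHeckeSetoid ιB hO n) :=
    { toFun := Quotient.map φ hφ
      invFun := Quotient.map ψ hψ
      left_inv := fun c => Quotient.inductionOn c fun a => by
        simp only [Quotient.map_mk]
        refine congrArg _ (Subtype.ext ?_)
        show g⁻¹ * (g * (a : GL (Fin 2) ℝ) * g⁻¹) * g = a
        group
      right_inv := fun c => Quotient.inductionOn c fun a => by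
        simp only [Quotient.map_mk]
        refine congrArg _ (Subtype.ext ?_)
        show g * (g⁻¹ * (a : GL (Fin 2) ℝ) * g) * g⁻¹ = a
        group }
  have he : ∀ c, e c = Quotient.map φ hφ c := fun c => rfl
  haveI : Fintype (Quotient (unitsHeckeSetoid ιB hO n)) := Fintype.ofEquiv _ e
  -- termwise comparison of the two sums
  have hterm : ∀ c : Quotient (unitsHeckeSetoid ιB' hO' n),
      (h ∣[(2 : ℤ)] g⁻¹) ∣[(2 : ℤ)] (((e c).out : unitsHeckeSet ιB (O := O) n) : GL (Fin 2) ℝ) =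
        (h ∣[(2 : ℤ)] ((c.out : unitsHeckeSet ιB' (O := O') n) : GL (Fin 2) ℝ)) ∣[(2 : ℤ)] g⁻¹ := by
    intro c
    have h1 : e c = Quotient.mk _ (φ c.out) := by
      conv_lhs => rw [he, ← Quotient.out_eq c]
      rfl
    have h2 : (unitsHeckeSetoid ιB hO n) (e c).out (φ c.out) := Quotient.exact (((e c).out_eq).trans h1)
    obtain ⟨γ, hγ, hγeq⟩ := h2
    have h3 : (((e c).out : unitsHeckeSet ιB (O := O) n) : GL (Fin 2) ℝ) =
        γ⁻¹ * (g * ((c.out : unitsHeckeSet ιB' (O := O') n) : GL (Fin 2) ℝ) * g⁻¹) := by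
      rw [eq_inv_mul_iff_mul_eq]; exact hγeq
    have hδ : g⁻¹ * γ⁻¹ * g ∈ normOneUnits ιB' hO' :=
      (conj_mem_normOneUnits_iff ιB hO ιB' hO' g HO _).mp
        (by rw [show g * (g⁻¹ * γ⁻¹ * g) * g⁻¹ = γ⁻¹ by group]; exact inv_mem hγ)
    rw [h3, ← SlashAction.slash_mul, ← SlashAction.slash_mul,
      show g⁻¹ * (γ⁻¹ * (g * ((c.out : unitsHeckeSet ιB' (O := O') n) : GL (Fin 2) ℝ) * g⁻¹)) =
        (g⁻¹ * γ⁻¹ * g) * (((c.out : unitsHeckeSet ιB' (O := O') n) : GL (Fin 2) ℝ) * g⁻¹) by group,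
      SlashAction.slash_mul, hh _ hδ]
  rw [unitsHeckeFun_eq_sum, unitsHeckeFun_eq_sum, SlashAction.sum_slash, ← Equiv.sum_comp e]
  exact Finset.sum_congr rfl fun c _ => hterm c

end Transport

/-! ## §2 (HT) the split Hecke transport -/

variable {D M : ℕ} {C : Finset ℕ}

/-- **(HT) THE CMRANK NODE'S STUB `stub_splitHeckeTransport` AS A THEOREM** (the def body of `SplitHeckeTransport` VERBATIM): for the X3 datum (`g`, order clause
`HO`, group clause `HΓ`) and the transported class-minimal form `F_s = Q'.form ∣ g⁻¹`, the split sub-order `O_s = {y ∈ O₀' : R.red y diagonal}` is an order with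
`ι(O_s) = {ι y : y ∈ O₀', red y diagonal}` and `T_ℓ^{O_s} F_s = a_ℓ(V)·F_s` for the primes `ℓ ∤ q·D·M·∏_C p`. [cite: ShimuraIATAF1971, §3.3 (3.3.12)–(3.3.14)]
[cite: KohenPacetti2016, §1.3 and §2] -/
theorem splitHeckeTransport :
    ∀ (V : WeierstrassCurve ℚ) [V.IsElliptic] [V.IsGloballyMinimal], ClassX11b V 3 → Surj V 3 →
    ∀ (N D M : ℕ) (C : Finset ℕ) (q : ℕ) [Fact q.Prime]
      (X : CartanLevelCurveData D M C) (W₁ : WeierstrassCurve ℚ) [W₁.IsElliptic] (Q : CartanParametrizationData X W₁)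
      (X' : CartanLevelCurveData D (M * q ^ 2) (C.erase q)) (W₂ : WeierstrassCurve ℚ) [W₂.IsElliptic]
      (Q' : CartanParametrizationData X' W₂) (hq : q ∈ C) (R : CoverReduction X q),
      V.conductorNorm ℤ = N → D * M * ∏ p ∈ C, p ^ 2 = N → q ≠ 3 → ¬ q ^ 3 ∣ N →
      3 ∣ (V.baseChange ℚ_[q]).localTamagawaNumber ℤ_[q] → Q.IsMinimalFor V → Q'.IsMinimalFor V →
      ∀ (g : GL (Fin 2) ℝ), 0 < g.det.val →
        (∀ m : Matrix (Fin 2) (Fin 2) ℝ, (∃ x ∈ X'.O, X'.ι x = m) ↔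
          ∃ y : coverSubring X q, (R.red y) 0 1 = 0 ∧ (R.red y) 1 0 = 0 ∧
            X.ι (y : X.B) = (g : Matrix (Fin 2) (Fin 2) ℝ) * m * ((g⁻¹ : GL (Fin 2) ℝ) : Matrix (Fin 2) (Fin 2) ℝ)) →
        (∀ γ : GL (Fin 2) ℝ, γ ∈ X'.Gamma ↔ g * γ * g⁻¹ ∈ R.levelOf (CartanTorusCubeCut.torusSubgroup (splitGen q))) →
        ∀ (F_s : CuspForm (R.levelOf (CartanTorusCubeCut.torusSubgroup (splitGen q))) 2),
          (⇑F_s : ℍ → ℂ) = ⇑Q'.form ∣[(2 : ℤ)] g⁻¹ →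
          ∃ (Os : Submodule ℤ X.B) (hOs : Brandt.IsOrder X.B Os),
            (∀ m : Matrix (Fin 2) (Fin 2) ℝ, (∃ x ∈ Os, X.ι x = m) ↔
              ∃ y : coverSubring X q, (R.red y) 0 1 = 0 ∧ (R.red y) 1 0 = 0 ∧ X.ι (y : X.B) = m) ∧
            ∀ ℓ : ℕ, ℓ.Prime → ¬ ℓ ∣ q * (D * M * ∏ p ∈ C, p) →
              unitsHeckeFun X.ι hOs ℓ (⇑F_s) = fun τ => ((V.LFunction ℓ : ℤ) : ℂ) * F_s τ := by
  intro V _ _ hX hS N D M C q _ X W₁ _ Q X' W₂ _ Q' hq R hN hDMC hq3 hq3N hc hQ hQ' g hg HO HΓ F_s hF_s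
  have hqP : q.Prime := Fact.out
  -- the split sub-order `O_s`
  let Os : Submodule ℤ X.B :=
    { carrier := {y | ∃ hy : y ∈ coverSubring X q, (R.red ⟨y, hy⟩) 0 1 = 0 ∧ (R.red ⟨y, hy⟩) 1 0 = 0}
      add_mem' := by
        rintro a b ⟨ha, ha1, ha2⟩ ⟨hb, hb1, hb2⟩
        refine ⟨add_mem ha hb, ?_, ?_⟩
        · have e : R.red ⟨a + b, add_mem ha hb⟩ = R.red ⟨a, ha⟩ + R.red ⟨b, hb⟩ := (map_add R.red ⟨a, ha⟩ ⟨b, hb⟩)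
          rw [e, Matrix.add_apply, ha1, hb1, add_zero]
        · have e : R.red ⟨a + b, add_mem ha hb⟩ = R.red ⟨a, ha⟩ + R.red ⟨b, hb⟩ := (map_add R.red ⟨a, ha⟩ ⟨b, hb⟩)
          rw [e, Matrix.add_apply, ha2, hb2, add_zero]
      zero_mem' := ⟨zero_mem _, by rw [show (⟨0, zero_mem _⟩ : coverSubring X q) = 0 from rfl, map_zero]; exact ⟨rfl, rfl⟩⟩
      smul_mem' := by
        rintro c a ⟨ha, ha1, ha2⟩
        refine ⟨(coverSubring X q).toAddSubgroup.zsmul_mem ha c, ?_⟩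
        have e : R.red ⟨c • a, (coverSubring X q).toAddSubgroup.zsmul_mem ha c⟩ = c • R.red ⟨a, ha⟩ :=
          map_zsmul R.red c ⟨a, ha⟩
        rw [e, Matrix.smul_apply, Matrix.smul_apply, ha1, ha2, smul_zero]
        exact ⟨rfl, rfl⟩ }
  have hOsmem : ∀ y : X.B, y ∈ Os ↔ ∃ hy : y ∈ coverSubring X q, (R.red ⟨y, hy⟩) 0 1 = 0 ∧ (R.red ⟨y, hy⟩) 1 0 = 0 :=
    fun y => Iff.rfl
  have hOsle : Os ≤ coverOrder X q := fun y hy => ((hOsmem y).mp hy).1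
  have hOs : Brandt.IsOrder X.B Os :=
    { one_mem := ⟨one_mem _, by
        rw [show (⟨1, one_mem _⟩ : coverSubring X q) = 1 from rfl, map_one]
        exact ⟨Matrix.one_apply_ne (by decide), Matrix.one_apply_ne (by decide)⟩⟩
      mul_mem := by
        rintro a ⟨ha, ha1, ha2⟩ b ⟨hb, hb1, hb2⟩
        refine ⟨mul_mem ha hb, ?_⟩
        have e : R.red ⟨a * b, mul_mem ha hb⟩ = R.red ⟨a, ha⟩ * R.red ⟨b, hb⟩ := map_mul R.red ⟨a, ha⟩ ⟨b, hb⟩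
        rw [e]
        constructor <;> simp [Matrix.mul_apply, Fin.sum_univ_two, ha1, ha2, hb1, hb2]
      isFullLattice := by
        refine isFullLattice_of_between (isOrder_coverOrder X q).isFullLattice hOsle (m := (q : ℤ))
          (by exact_mod_cast hqP.ne_zero) fun x hx => ?_
        refine ⟨(coverSubring X q).toAddSubgroup.zsmul_mem hx (q : ℤ), ?_⟩
        have e : R.red ⟨(q : ℤ) • x, (coverSubring X q).toAddSubgroup.zsmul_mem hx (q : ℤ)⟩ = (q : ℤ) • R.red ⟨x, hx⟩ :=
          map_zsmul R.red (q : ℤ) ⟨x, hx⟩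
        rw [e, Matrix.smul_apply, Matrix.smul_apply, zsmul_eq_mul, zsmul_eq_mul, Int.cast_natCast, ZMod.natCast_self,
          zero_mul, zero_mul]
        exact ⟨rfl, rfl⟩ }
  have hOsι : ∀ m : Matrix (Fin 2) (Fin 2) ℝ, (∃ x ∈ Os, X.ι x = m) ↔
      ∃ y : coverSubring X q, (R.red y) 0 1 = 0 ∧ (R.red y) 1 0 = 0 ∧ X.ι (y : X.B) = m := by
    intro m
    constructor
    · rintro ⟨x, ⟨hx, h1, h2⟩, hxm⟩
      exact ⟨⟨x, hx⟩, h1, h2, hxm⟩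
    · rintro ⟨y, h1, h2, hym⟩
      exact ⟨(y : X.B), ⟨y.2, h1, h2⟩, hym⟩
  refine ⟨Os, hOs, hOsι, ?_⟩
  intro ℓ hℓ hnd
  -- the order clause in the currency of `O_s`
  have HO' : ∀ m : Matrix (Fin 2) (Fin 2) ℝ, (∃ x ∈ X'.O, X'.ι x = m) ↔
      ∃ y ∈ Os, X.ι y = (g : Matrix (Fin 2) (Fin 2) ℝ) * m * ((g⁻¹ : GL (Fin 2) ℝ) : Matrix (Fin 2) (Fin 2) ℝ) := by
    intro m
    rw [HO m, ← hOsι]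
  -- the divisibility condition of `Q'.hecke_eq`
  have hnd' : ¬ ℓ ∣ D * (M * q ^ 2) * ∏ p ∈ C.erase q, p := by
    have e : D * (M * q ^ 2) * ∏ p ∈ C.erase q, p = q * (D * M * ∏ p ∈ C, p) := by
      rw [← Finset.mul_prod_erase C (fun p => p) hq]; ring
    rwa [e]
  -- finiteness of the coset space `X'.Γ∖X'.O(ℓ)` (HD)
  obtain ⟨hfin, -⟩ := cartanLevel_card_heckeCosets_eq_holds D (M * q ^ 2) (C.erase q) X' ℓ hℓ hnd'
  haveI : Finite (Quotient (unitsHeckeSetoid X'.ι X'.isOrder ℓ)) := hfin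
  haveI : Fintype (Quotient (unitsHeckeSetoid X'.ι X'.isOrder ℓ)) := Fintype.ofFinite _
  -- invariance of `Q'.form` under `X'.Gamma = ι'(X'.O¹)`
  have hinv : ∀ δ ∈ normOneUnits X'.ι X'.isOrder, (⇑Q'.form : ℍ → ℂ) ∣[(2 : ℤ)] δ = ⇑Q'.form := fun δ hδ =>
    SlashInvariantForm.slash_action_eqn Q'.form δ hδ
  have htrans := unitsHeckeFun_slash_conj X.ι hOs X'.ι X'.isOrder g HO' ℓ (⇑Q'.form) hinv
  have hX' : unitsHeckeFun X'.ι X'.isOrder ℓ (⇑Q'.form) = X'.heckeFun ℓ (⇑Q'.form) := rfl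
  rw [hF_s, htrans, hX', Q'.hecke_eq ℓ hℓ hnd', LFunction_eq_of_isIsogenous_holds V W₂ hQ'.1]
  have e : (fun τ => (((W₂.LFunction ℓ : ℤ)) : ℂ) * Q'.form τ) = (((W₂.LFunction ℓ : ℤ)) : ℂ) • (⇑Q'.form : ℍ → ℂ) := rfl
  rw [e, ModularForm.smul_slash, map_intCast]
  rfl

end Summit.BirchSwinnertonDyer.BirchSwinnertonDyer.Theorems.CartanCover.CMRank

end
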